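import Summits.Parity.GeneralizedHardyLittlewood.Theorems.PrimeLevelFamEdgeMomentsBeyondDiagonalDiagDivisorPairs
import HarnessLib

/-!
# Route `PrimeLevelFamEdge`, crux K_A `MomentsBeyondDiagonal` (stmt-Parity-20007), line «petersson_layers» v4, stub `stub_diag`:
# **the Hecke-divisor coordinates of the line series are the ordered factorisations `n₁n₂ = (m₁/c)(m₂/c)` (census R3(ii), brick)**

The explicit line series of `…DiagLineSeries` / `…DiagShapeOfSeries.subDiag_of_lineSeries` sums, for a mollifier pair
`(m₁, m₂)`, over the Hecke divisors `d₁ ∣ m₁, d₂ ∣ m₂` a weight of `c = gcd(m₁/d₁, m₂/d₂)` and of the two AFE variables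
`n₁ = d₁e₁`, `n₂ = d₂e₂` (`e₁ = (m₂/d₂)/c`, `e₂ = (m₁/d₁)/c`, `n₁n₂ = (m₁/c)(m₂/c)`). This file identifies those coordinates
with the kernel coordinates of the `Q = 1` chain (`Corner.hKernel`: `Σ_{c ∣ (m₁,m₂)} c·Σ_{D ∣ (m₁/c)(m₂/c)} …`), now keeping
the ordered factorisation:

* `sum_hecke_divisors_eq_sum_gcd_sum_factorisations` — **for `m₁, m₂ ≥ 1` and ANY weight `Φ(c, n₁, n₂)`,
  `Σ_{d₁∣m₁}Σ_{d₂∣m₂} Φ(gcd(m₁/d₁,m₂/d₂), d₁·((m₂/d₂)/c), d₂·((m₁/d₁)/c)) = Σ_{c ∣ gcd(m₁,m₂)} Σ_{D ∣ (m₁/c)(m₂/c)} Φ(c, D, (m₁/c)(m₂/c)/D)`**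
  (co-divisors `a_ν = m_ν/d_ν`, sorted by `c = gcd(a₁,a₂)` via `sum_divisorPairs_eq_sum_gcd_fibres`, then the coprime pairs of
  `(m₁/c, m₂/c)` are the divisors of the product via `sum_divisors_mul_eq_sum_coprime_pairs`).
With `…DiagDecoratedReindex.quadForm_decorated_eq` this puts the general-`Q` line series into decorated Selberg coordinates.

Def-free; theorems only. Helper `--supports stmt-Parity-20007`; closes nothing; K_A, K_B and the Parity summit are NOT
proved; nothing about Landau–Siegel zeros.

## References
* E. Kowalski, P. Michel, J. VanderKam, J. reine angew. Math. 526 (2000), (10) p. 7 and (21)–(23) pp. 12–13.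
  [cite: KowalskiMichelVanderKam2000, (21)–(23) — derivation (Hecke recursion of the diagonal, ordered factorisations)]
-/

open Finset

namespace Summit.Parity.GeneralizedHardyLittlewood.Theorems.MomentsBeyondDiagonal.DiagLines

/-- **Hecke divisors ↔ ordered factorisations.** For `m₁, m₂ ≥ 1` and any weight `Φ(c, n₁, n₂)`:
`Σ_{d₁∣m₁} Σ_{d₂∣m₂} Φ(gcd(m₁/d₁, m₂/d₂), d₁·((m₂/d₂)/gcd), d₂·((m₁/d₁)/gcd))
 = Σ_{c ∣ gcd(m₁,m₂)} Σ_{D ∣ (m₁/c)(m₂/c)} Φ(c, D, (m₁/c)(m₂/c)/D)`.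
[cite: KowalskiMichelVanderKam2000, (21)–(23) — derivation (Hecke recursion of the diagonal, ordered factorisations)] -/
theorem sum_hecke_divisors_eq_sum_gcd_sum_factorisations {M : Type*} [AddCommMonoid M] {m₁ m₂ : ℕ}
    (h₁ : m₁ ≠ 0) (h₂ : m₂ ≠ 0) (Φ : ℕ → ℕ → ℕ → M) :
    ∑ d₁ ∈ m₁.divisors, ∑ d₂ ∈ m₂.divisors,
        Φ ((m₁ / d₁).gcd (m₂ / d₂)) (d₁ * (m₂ / d₂ / (m₁ / d₁).gcd (m₂ / d₂)))
          (d₂ * (m₁ / d₁ / (m₁ / d₁).gcd (m₂ / d₂))) =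
      ∑ c ∈ (Nat.gcd m₁ m₂).divisors, ∑ D ∈ (m₁ / c * (m₂ / c)).divisors, Φ c D (m₁ / c * (m₂ / c) / D) := by
  -- Step 1: pass to the co-divisors `a₁ = m₁/d₁`, `a₂ = m₂/d₂` (`d_ν = m_ν/a_ν`)
  set H : ℕ → ℕ → M := fun a₁ a₂ ↦
    Φ (a₁.gcd a₂) (m₁ / a₁ * (a₂ / a₁.gcd a₂)) (m₂ / a₂ * (a₁ / a₁.gcd a₂)) with hH
  have step1 : ∑ d₁ ∈ m₁.divisors, ∑ d₂ ∈ m₂.divisors,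
      Φ ((m₁ / d₁).gcd (m₂ / d₂)) (d₁ * (m₂ / d₂ / (m₁ / d₁).gcd (m₂ / d₂)))
        (d₂ * (m₁ / d₁ / (m₁ / d₁).gcd (m₂ / d₂))) =
      ∑ a₁ ∈ m₁.divisors, ∑ a₂ ∈ m₂.divisors, H a₁ a₂ := by
    have hre : ∀ d₁ ∈ m₁.divisors, ∀ d₂ ∈ m₂.divisors,
        Φ ((m₁ / d₁).gcd (m₂ / d₂)) (d₁ * (m₂ / d₂ / (m₁ / d₁).gcd (m₂ / d₂)))
          (d₂ * (m₁ / d₁ / (m₁ / d₁).gcd (m₂ / d₂))) = H (m₁ / d₁) (m₂ / d₂) := by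
      intro d₁ hd₁ d₂ hd₂
      have hd₁' := (Nat.mem_divisors.1 hd₁).1
      have hd₂' := (Nat.mem_divisors.1 hd₂).1
      simp only [hH]
      rw [Nat.div_div_self hd₁' h₁, Nat.div_div_self hd₂' h₂]
    rw [Finset.sum_congr rfl fun d₁ hd₁ ↦ Finset.sum_congr rfl fun d₂ hd₂ ↦ hre d₁ hd₁ d₂ hd₂]
    rw [Nat.sum_div_divisors m₁ (fun a₁ ↦ ∑ d₂ ∈ m₂.divisors, H a₁ (m₂ / d₂))]
    exact Finset.sum_congr rfl fun a₁ _ ↦ Nat.sum_div_divisors m₂ (fun a₂ ↦ H a₁ a₂)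
  rw [step1, sum_divisorPairs_eq_sum_gcd_fibres h₁ h₂ H]
  -- Step 2: on the fibre `gcd = c` the weight is `Φ(c, (U/e₂)e₁, e₂(V/e₁))`, `U = m₁/c`, `V = m₂/c`
  refine Finset.sum_congr rfl fun c hc ↦ ?_
  obtain ⟨hcg, -⟩ := Nat.mem_divisors.mp hc
  have hcu : c ∣ m₁ := hcg.trans (Nat.gcd_dvd_left m₁ m₂)
  have hcv : c ∣ m₂ := hcg.trans (Nat.gcd_dvd_right m₁ m₂)
  have hc0 : c ≠ 0 := by rintro rfl; exact h₁ (zero_dvd_iff.mp hcu)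
  have hcpos : 0 < c := Nat.pos_of_ne_zero hc0
  have huc : m₁ / c ≠ 0 := (Nat.div_ne_zero_iff_of_dvd hcu).mpr ⟨h₁, hc0⟩
  have hvc : m₂ / c ≠ 0 := (Nat.div_ne_zero_iff_of_dvd hcv).mpr ⟨h₂, hc0⟩
  have hfibre : ∀ p ∈ ((m₁ / c).divisors ×ˢ (m₂ / c).divisors).filter (fun p => Nat.Coprime p.1 p.2),
      H (c * p.1) (c * p.2) = Φ c (m₁ / c / p.1 * p.2) (p.1 * (m₂ / c / p.2)) := by
    rintro ⟨e₂, e₁⟩ hp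
    simp only [mem_filter, mem_product, Nat.mem_divisors] at hp
    obtain ⟨⟨⟨-, -⟩, ⟨-, -⟩⟩, hcop⟩ := hp
    have hg : Nat.gcd (c * e₂) (c * e₁) = c := by
      rw [Nat.gcd_mul_left, Nat.Coprime.gcd_eq_one hcop, mul_one]
    simp only [hH]
    rw [hg, Nat.mul_div_cancel_left e₁ hcpos, Nat.mul_div_cancel_left e₂ hcpos,
      ← Nat.div_div_eq_div_mul m₁ c e₂, ← Nat.div_div_eq_div_mul m₂ c e₁, mul_comm (m₂ / c / e₁) e₂]
  rw [Finset.sum_congr rfl hfibre]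
  -- Step 3: the coprime pairs of `(m₁/c, m₂/c)` are the divisors of the product
  exact (sum_divisors_mul_eq_sum_coprime_pairs huc hvc (fun D D' ↦ Φ c D D')).symm


/-- **The same, carrying the product `K = (m₁/c)(m₂/c) = n₁n₂` as a fourth argument** (the form in which
`…DiagShapeOfSeries.subDiag_of_lineSeries` writes the line series: the Bose cut-off sits at `K/q̂²` with
`K = (m₁/gcd)(m₂/gcd)`): for `m₁, m₂ ≥ 1` and any `Ψ(c, n₁, n₂, K)`,
`Σ_{d₁∣m₁}Σ_{d₂∣m₂} Ψ(gcd, d₁(m₂/d₂)/gcd, d₂(m₁/d₁)/gcd, (m₁/gcd)(m₂/gcd)) = Σ_{c∣(m₁,m₂)} Σ_{D∣(m₁/c)(m₂/c)} Ψ(c, D, (m₁/c)(m₂/c)/D, (m₁/c)(m₂/c))`.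
[cite: KowalskiMichelVanderKam2000, (21)–(23) — derivation (Hecke recursion of the diagonal, ordered factorisations)] -/
theorem sum_hecke_divisors_eq_sum_gcd_sum_factorisations' {M : Type*} [AddCommMonoid M] {m₁ m₂ : ℕ}
    (h₁ : m₁ ≠ 0) (h₂ : m₂ ≠ 0) (Ψ : ℕ → ℕ → ℕ → ℕ → M) :
    ∑ d₁ ∈ m₁.divisors, ∑ d₂ ∈ m₂.divisors,
        Ψ ((m₁ / d₁).gcd (m₂ / d₂)) (d₁ * (m₂ / d₂ / (m₁ / d₁).gcd (m₂ / d₂)))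
          (d₂ * (m₁ / d₁ / (m₁ / d₁).gcd (m₂ / d₂)))
          (m₁ / (m₁ / d₁).gcd (m₂ / d₂) * (m₂ / (m₁ / d₁).gcd (m₂ / d₂))) =
      ∑ c ∈ (Nat.gcd m₁ m₂).divisors, ∑ D ∈ (m₁ / c * (m₂ / c)).divisors,
        Ψ c D (m₁ / c * (m₂ / c) / D) (m₁ / c * (m₂ / c)) := by
  -- on the left `(m₁/c)(m₂/c) = n₁·n₂`, on the right `(m₁/c)(m₂/c) = D·((m₁/c)(m₂/c)/D)`
  have hL : ∀ d₁ ∈ m₁.divisors, ∀ d₂ ∈ m₂.divisors,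
      m₁ / (m₁ / d₁).gcd (m₂ / d₂) * (m₂ / (m₁ / d₁).gcd (m₂ / d₂)) =
        d₁ * (m₂ / d₂ / (m₁ / d₁).gcd (m₂ / d₂)) * (d₂ * (m₁ / d₁ / (m₁ / d₁).gcd (m₂ / d₂))) := by
    intro d₁ hd₁ d₂ hd₂
    have hd₁' := (Nat.mem_divisors.1 hd₁).1
    have hd₂' := (Nat.mem_divisors.1 hd₂).1
    set a₁ := m₁ / d₁ with ha₁
    set a₂ := m₂ / d₂ with ha₂
    set g := a₁.gcd a₂ with hg
    have hm₁ : m₁ = d₁ * a₁ := (Nat.mul_div_cancel' hd₁').symm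
    have hm₂ : m₂ = d₂ * a₂ := (Nat.mul_div_cancel' hd₂').symm
    have e₁ : m₁ / g = d₁ * (a₁ / g) := by
      conv_lhs => rw [hm₁]
      exact Nat.mul_div_assoc d₁ (Nat.gcd_dvd_left a₁ a₂)
    have e₂ : m₂ / g = d₂ * (a₂ / g) := by
      conv_lhs => rw [hm₂]
      exact Nat.mul_div_assoc d₂ (Nat.gcd_dvd_right a₁ a₂)
    rw [e₁, e₂]
    ring
  have hR : ∀ c ∈ (Nat.gcd m₁ m₂).divisors, ∀ D ∈ (m₁ / c * (m₂ / c)).divisors,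
      m₁ / c * (m₂ / c) = D * (m₁ / c * (m₂ / c) / D) := by
    intro c _ D hD
    exact (Nat.mul_div_cancel' (Nat.mem_divisors.1 hD).1).symm
  rw [Finset.sum_congr rfl fun d₁ hd₁ ↦ Finset.sum_congr rfl fun d₂ hd₂ ↦
      congrArg (Ψ ((m₁ / d₁).gcd (m₂ / d₂)) (d₁ * (m₂ / d₂ / (m₁ / d₁).gcd (m₂ / d₂)))
        (d₂ * (m₁ / d₁ / (m₁ / d₁).gcd (m₂ / d₂)))) (hL d₁ hd₁ d₂ hd₂)]
  rw [sum_hecke_divisors_eq_sum_gcd_sum_factorisations h₁ h₂ (fun c n₁ n₂ ↦ Ψ c n₁ n₂ (n₁ * n₂))]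
  exact Finset.sum_congr rfl fun c hc ↦ Finset.sum_congr rfl fun D hD ↦
    congrArg (Ψ c D (m₁ / c * (m₂ / c) / D)) (hR c hc D hD).symm

end Summit.Parity.GeneralizedHardyLittlewood.Theorems.MomentsBeyondDiagonal.DiagLines
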